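import Literature.Barriers.HodgeConjecture.GeneralizedHodgeTrivialReasonsEllipticCurveCubedRational
import Literature.AlgebraicGeometry.HodgeTheory.WeilSurfaceSquareTorus
import HarnessLib

/-!
# The rational classes of `H²(ℂ²/(ℤ + τℤ)²; ℂ)` contain `c · e[dx_a ∧ dx_b]` for one scalar `c ≠ 0`

Rational structure of the degree-`2` cohomology of the complex torus `T_τ = ℂ²/(ℤ + τℤ)²`
(`WeilSquare.Torus τ`, the analytification of `E_τ × E_τ`), in the shape needed for the Weil-type
abelian surface of `exists_weilType_abelianSurfaces`: for every NATURAL complex de Rham isomorphism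
family `e` on manifolds charted on `ℂ²` there is ONE scalar `c ≠ 0` such that the six classes
`c · e[dx_a ∧ dx_b ∧ 1]`, `a < b` (lattice monomials of the lattice frame, `ComplexTorus.latMonomial`),
are RATIONAL classes of `H²(T_τ; ℂ)` (`WeilSquare.exists_smul_deRhamBasis_isRationalClass`).
Lange–Birkenhake (1992), Lemma 1.1.17 with Prop. 1.1.20: the `dx_I` are the basis dual to the
integral basis `λ_{i₁} ∧ λ_{i₂}` of `H₂(T; ℤ)`. Here, exactly as for the cube
(`Literature/Barriers/HodgeConjecture/GeneralizedHodgeTrivialReasonsEllipticCurveCubedRational`,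
whose general lemmas are reused): the rational classes form a rational `ℚ`-subspace of full size
`6 = b₂` (universal coefficients over `ℚ` and `ℂ`, flat base change, and `dim H²_dR = C(4,2) = 6`
through `e` and `ComplexTorus.cconstClassEquiv`), stable under the pull-backs along the signed
permutations of the lattice basis, which act monomially on the `e[dx_I]` by naturality of `e`
(`cmap_cconstClass_latMonomial_signedPerm`); the sign changes separate the six `I` and the
permutations are transitive, so the rigidity lemma
`Literature.LinearAlgebra.RationalForms.exists_ratBasis_smul_basis_of_signOperators` applies.

## References

* H. Lange, Ch. Birkenhake, *Complex Abelian Varieties* (1992), §1.1.2, §1.1.3 Lemma 1.1.17,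
  §1.1.4 Prop. 1.1.20, Exercise 1.1.6 (8). [LangeBirkenhake1992]
* A. Hatcher, *Algebraic Topology* (2002), §3.1 Thm. 3.2, §3.A Thm. 3A.3. [HatcherAT2002]
-/

noncomputable section

open scoped Manifold ContDiff
open Function Module
open Literature.Geometry.Kaehler Literature.NumberTheory.Transcendental
open Literature.AlgebraicTopology.SingularHomology Literature.LinearAlgebra.RationalForms
open Literature.Barriers.HodgeConjecture (signedPermMatrix cmap_cconstClass_latMonomial_signedPerm
  prod_signFlip_eq exists_perm_comp_eq prod_sign_eq_one_or isRatSubspace_isRationalClass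
  isRational_isRationalClass)

namespace Literature.AlgebraicGeometry.HodgeTheory

namespace WeilSquare

/-! ### The six increasing `2`-words over `Fin 4` -/

/-- The six increasing words `01, 02, 03, 12, 13, 23` (the index sets `I`, `#I = 2`).
[cite: LangeBirkenhake1992, §1.1.4 Prop. 1.1.20] -/
def sqWord : Fin 6 → Fin 2 → Fin 4 :=
  ![![0, 1], ![0, 2], ![0, 3], ![1, 2], ![1, 3], ![2, 3]]

/-- The words are increasing. [folklore] -/
theorem strictMono_sqWord : ∀ j, StrictMono (sqWord j) := by
  unfold sqWord StrictMono
  decide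

/-- The words are pairwise distinct. [folklore] -/
theorem injective_sqWord : Function.Injective sqWord := by
  unfold sqWord Function.Injective
  decide

/-- Each word is an injective map. [folklore] -/
theorem injective_sqWord_apply (j : Fin 6) : Function.Injective (sqWord j) :=
  (strictMono_sqWord j).injective

/-- There are exactly `C(4,2) = 6` increasing words of length `2` over `Fin 4`. [folklore] -/
theorem card_strictMono_two : Fintype.card {w : Fin 2 → Fin 4 // StrictMono w} = 6 := by
  unfold StrictMono
  decide

/-- The enumeration of the increasing words by `Fin 6`. [folklore] -/
def sqWordEquiv : Fin 6 ≃ {w : Fin 2 → Fin 4 // StrictMono w} :=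
  Equiv.ofBijective (fun j ↦ ⟨sqWord j, strictMono_sqWord j⟩)
    ((Fintype.bijective_iff_injective_and_card _).2
      ⟨fun j j' h ↦ injective_sqWord (congrArg Subtype.val h), by rw [card_strictMono_two, Fintype.card_fin]⟩)

/-- `sqWordEquiv j = sqWord j`. [folklore] -/
@[simp] theorem sqWordEquiv_apply_val (j : Fin 6) : (sqWordEquiv j).1 = sqWord j := rfl

/-- **The sign changes separate the words**: two distinct words differ in the membership of some
lattice index. [folklore] -/
theorem exists_mem_sqWord_xor {j j' : Fin 6} (hjj' : j ≠ j') :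
    ∃ p : Fin 4, ¬ ((∃ i, sqWord j i = p) ↔ (∃ i, sqWord j' i = p)) := by
  revert j j'
  unfold sqWord
  decide

/-! ### The de Rham basis of `H²_dR(ℂ²/(ℤ + τℤ)²; ℂ)` -/

section DeRham

variable (τ : ℂ) (hτ : τ.im ≠ 0)

/-- **The de Rham basis** `[dx_a ∧ dx_b ∧ 1]`, `a < b`, of `H²_dR(T_τ; ℂ)` (Lange–Birkenhake
Prop. 1.1.20: the increasing lattice monomials form a basis, `ComplexTorus.latMonomialBasis`,
transported by `ComplexTorus.cconstClassEquiv`). [cite: LangeBirkenhake1992, §1.1.4 Prop. 1.1.20] -/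
def deRhamBasis : Module.Basis (Fin 6) ℂ (complexDeRhamCohomology (Fin 2 → ℂ) (Torus τ hτ) 2) :=
  ((ComplexTorus.latMonomialBasis (periodIso τ hτ) 2).reindex sqWordEquiv.symm).map
    (ComplexTorus.cconstClassEquiv (periodIso τ hτ))

/-- The basis vectors are the classes of the lattice monomials of the six words.
[cite: LangeBirkenhake1992, §1.1.4 Prop. 1.1.20] -/
theorem deRhamBasis_apply (j : Fin 6) :
    deRhamBasis τ hτ j = ComplexTorus.cconstClass (periodIso τ hτ)
      (ComplexTorus.latMonomial (periodIso τ hτ) 2 (sqWord j)) := by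
  rw [deRhamBasis, Module.Basis.map_apply, Module.Basis.reindex_apply, Equiv.symm_symm,
    ComplexTorus.latMonomialBasis_apply, ComplexTorus.cconstClassEquiv_apply, sqWordEquiv_apply_val]

/-- **`dim_ℂ H²_dR(ℂ²/(ℤ + τℤ)²; ℂ) = 6 = C(4,2)`.** [cite: LangeBirkenhake1992, §1.1.4 Prop. 1.1.20 and Exercise 1.1.6 (8)] -/
theorem finrank_complexDeRham_two : Module.finrank ℂ (complexDeRhamCohomology (Fin 2 → ℂ) (Torus τ hτ) 2) = 6 := by
  rw [Module.finrank_eq_card_basis (deRhamBasis τ hτ), Fintype.card_fin]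

variable (e : ComplexDeRhamIsoFamily (Fin 2 → ℂ))

/-- The comparison `H²_dR(T_τ; ℂ) ≃ H²(T_τ; ℂ)` given by the family `e` (a named constant).
[cite: WellsDACM1980, Thm. III.4.13] -/
def deRhamIso : complexDeRhamCohomology (Fin 2 → ℂ) (Torus τ hτ) 2 ≃ₗ[ℂ] singularCohomology ℂ ℂ (Torus τ hτ) 2 :=
  e (Torus τ hτ) 2

/-- Unfolding of `deRhamIso`. [folklore] -/
theorem deRhamIso_apply (x : complexDeRhamCohomology (Fin 2 → ℂ) (Torus τ hτ) 2) :
    deRhamIso τ hτ e x = e (Torus τ hτ) 2 x := rfl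

/-- The **singular basis** of `H²(T_τ; ℂ)` attached to `e`: the image of `deRhamBasis`.
[cite: LangeBirkenhake1992, §1.1.4 Prop. 1.1.20] -/
def singBasis : Module.Basis (Fin 6) ℂ (singularCohomology ℂ ℂ (Torus τ hτ) 2) :=
  (deRhamBasis τ hτ).map (deRhamIso τ hτ e)

/-- The singular basis vectors. [cite: LangeBirkenhake1992, §1.1.4 Prop. 1.1.20] -/
theorem singBasis_apply (j : Fin 6) : singBasis τ hτ e j = deRhamIso τ hτ e (deRhamBasis τ hτ j) := by
  rw [singBasis, Module.Basis.map_apply]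

include e in
/-- **`b₂(T_τ) = 6` on the singular side, through `e`.** [cite: LangeBirkenhake1992, §1.1.3 Lemma 1.1.17 and Exercise 1.1.6 (8)] -/
theorem finrank_singularCohomology_two_eq : Module.finrank ℂ (singularCohomology ℂ ℂ (Torus τ hτ) 2) = 6 := by
  rw [← (deRhamIso τ hτ e).finrank_eq, finrank_complexDeRham_two]

include e in
/-- **`dim_ℚ H²(T_τ; ℚ) = 6`** (universal coefficients over the fields `ℚ`, `ℂ` and flat base change).
[cite: HatcherAT2002, §3.1 Thm. 3.2 and §3.A Thm. 3A.3] -/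
theorem finrank_singularCohomology_rat_two_eq : Module.finrank ℚ (singularCohomology ℚ ℚ (Torus τ hτ) 2) = 6 := by
  rw [finrank_singularCohomology_eq_bettiNumber_of_field, bettiNumber_eq_of_algebra ℚ ℂ,
    ← finrank_singularCohomology_eq_bettiNumber_of_field, finrank_singularCohomology_two_eq τ hτ e]

include e in
/-- **Six `ℚ`-independent rational classes in `H²(T_τ; ℂ)`** (the image of a `ℚ`-basis of `H²(T_τ; ℚ)`).
[cite: HatcherAT2002, §3.1 Thm. 3.2 and p. 198] -/
theorem exists_full_isRationalClass :
    ∃ f : Fin 6 → singularCohomology ℂ ℂ (Torus τ hτ) 2,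
      (∀ i, f i ∈ {c : singularCohomology ℂ ℂ (Torus τ hτ) 2 | IsRationalClass c}) ∧
      ∀ q : Fin 6 → ℚ, ∑ i, ((q i : ℚ) : ℂ) • f i = 0 → q = 0 := by
  have hfin : Module.Finite ℚ (singularCohomology ℚ ℚ (Torus τ hτ) 2) :=
    Module.finite_of_finrank_pos (by rw [finrank_singularCohomology_rat_two_eq τ hτ e]; norm_num)
  let bQ := Module.finBasisOfFinrankEq ℚ _ (finrank_singularCohomology_rat_two_eq τ hτ e)
  refine ⟨fun i ↦ singularCohomology.ringChange (algebraMap ℚ ℂ) _ 2 (bQ i),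
    fun i ↦ isRationalClass_ringChange (bQ i), ?_⟩
  exact (linearIndependent_iff_of_isRationalClass fun i ↦ isRationalClass_ringChange (bQ i)).1
    ((linearIndependent_ringChange_iff _).2 bQ.linearIndependent)

/-- The pull-back along the endomorphism `mapMatrix A` of `T_τ`, as a linear endomorphism of `H²(T_τ; ℂ)`.
[cite: LangeBirkenhake1992, §1.1.2] -/
def torusPullback (A : Matrix (Fin 4) (Fin 4) ℤ) :
    singularCohomology ℂ ℂ (Torus τ hτ) 2 →ₗ[ℂ] singularCohomology ℂ ℂ (Torus τ hτ) 2 :=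
  (singularCohomology.map ℂ ℂ
    ⟨ComplexTorus.mapMatrix (periodIso τ hτ) (periodIso τ hτ) A,
      (ComplexTorus.contMDiff_real_mapMatrix (Φ := periodIso τ hτ) (Φ' := periodIso τ hτ)
        (n := ∞) A).continuous⟩ 2).hom

/-- Unfolding of `torusPullback`. [folklore] -/
theorem torusPullback_apply (A : Matrix (Fin 4) (Fin 4) ℤ) (s : singularCohomology ℂ ℂ (Torus τ hτ) 2) :
    torusPullback τ hτ A s = singularCohomology.map ℂ ℂ
      ⟨ComplexTorus.mapMatrix (periodIso τ hτ) (periodIso τ hτ) A,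
        (ComplexTorus.contMDiff_real_mapMatrix (Φ := periodIso τ hτ) (Φ' := periodIso τ hτ)
          (n := ∞) A).continuous⟩ 2 s := rfl

/-- Pull-backs preserve rational classes. [cite: HatcherAT2002, §3.1 p. 198] -/
theorem torusPullback_mem (A : Matrix (Fin 4) (Fin 4) ℤ) {s : singularCohomology ℂ ℂ (Torus τ hτ) 2}
    (hs : IsRationalClass s) : IsRationalClass (torusPullback τ hτ A s) :=
  hs.map _

variable {e} (he : e.IsNatural)

include he in
/-- **Naturality of `e` under the endomorphisms `mapMatrix A`**: `(mapMatrix A)^*(e[c]) = e((mapMatrix A)^*[c])`.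
[cite: BottTu1982Forms, §I.5] -/
theorem torusPullback_deRhamIso (A : Matrix (Fin 4) (Fin 4) ℤ) (c : complexDeRhamCohomology (Fin 2 → ℂ) (Torus τ hτ) 2) :
    torusPullback τ hτ A (deRhamIso τ hτ e c) =
      deRhamIso τ hτ e (complexDeRhamCohomology.map (Fin 2 → ℂ)
        (ComplexTorus.contMDiff_real_mapMatrix (Φ := periodIso τ hτ) (Φ' := periodIso τ hτ) (n := ∞) A) 2 c) :=
  (he _ _ _ (ComplexTorus.contMDiff_real_mapMatrix (Φ := periodIso τ hτ) (Φ' := periodIso τ hτ)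
    (n := ∞) A) 2 _).symm

include he in
/-- **Signed permutations act monomially on the singular basis**: `(mapMatrix A)^*(e[dx_w]) = (∏ s_{w i}) e[dx_{π∘w}]`.
[cite: LangeBirkenhake1992, §1.1.2 and §1.1.4] -/
theorem torusPullback_e_latMonomial (s : Fin 4 → ℤ) (π : Equiv.Perm (Fin 4)) (w : Fin 2 → Fin 4) :
    torusPullback τ hτ (signedPermMatrix s π)
        (deRhamIso τ hτ e (ComplexTorus.cconstClass (periodIso τ hτ)
          (ComplexTorus.latMonomial (periodIso τ hτ) 2 w))) =
      ((∏ i, s (w i) : ℤ) : ℂ) • deRhamIso τ hτ e (ComplexTorus.cconstClass (periodIso τ hτ)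
          (ComplexTorus.latMonomial (periodIso τ hτ) 2 (π ∘ w))) := by
  rw [← map_smul, ← cmap_cconstClass_latMonomial_signedPerm (periodIso τ hτ) s π 2 w,
    torusPullback_deRhamIso τ hτ he]

include he in
/-- **Sign symmetries** separating the singular basis vectors. [cite: LangeBirkenhake1992, §1.1.2 and §1.1.4] -/
theorem exists_signOperator {j j' : Fin 6} (hjj' : j ≠ j') :
    ∃ P : singularCohomology ℂ ℂ (Torus τ hτ) 2 →ₗ[ℂ] singularCohomology ℂ ℂ (Torus τ hτ) 2,
      (∀ s ∈ {c : singularCohomology ℂ ℂ (Torus τ hτ) 2 | IsRationalClass c},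
        P s ∈ {c : singularCohomology ℂ ℂ (Torus τ hτ) 2 | IsRationalClass c}) ∧
      ∃ ε : Fin 6 → ℂ, (∀ v, ε v = 1 ∨ ε v = -1) ∧
        (∀ v, P (singBasis τ hτ e v) = ε v • singBasis τ hτ e v) ∧ ε j ≠ ε j' := by
  classical
  obtain ⟨p, hp⟩ := exists_mem_sqWord_xor hjj'
  let s : Fin 4 → ℤ := fun q ↦ if q = p then -1 else 1
  have hs : ∀ q, s q = 1 ∨ s q = -1 := fun q ↦ by
    simp only [s]; split_ifs <;> simp
  have hv : ∀ v, (∏ i, s (sqWord v i)) = if p ∈ Set.range (sqWord v) then -1 else 1 :=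
    fun v ↦ prod_signFlip_eq p (injective_sqWord_apply v)
  refine ⟨torusPullback τ hτ (signedPermMatrix s 1),
    fun x hx ↦ torusPullback_mem τ hτ _ hx,
    fun v ↦ ((∏ i, s (sqWord v i) : ℤ) : ℂ), fun v ↦ ?_, fun v ↦ ?_, ?_⟩
  · show ((∏ i, s (sqWord v i) : ℤ) : ℂ) = 1 ∨ ((∏ i, s (sqWord v i) : ℤ) : ℂ) = -1
    rcases prod_sign_eq_one_or s hs (sqWord v) with h | h
    · left; rw [h, Int.cast_one]
    · right; rw [h, Int.cast_neg, Int.cast_one]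
  · show torusPullback τ hτ (signedPermMatrix s 1) (singBasis τ hτ e v) =
      ((∏ i, s (sqWord v i) : ℤ) : ℂ) • singBasis τ hτ e v
    rw [singBasis_apply, deRhamBasis_apply, torusPullback_e_latMonomial τ hτ he]
    rfl
  · show ((∏ i, s (sqWord j i) : ℤ) : ℂ) ≠ ((∏ i, s (sqWord j' i) : ℤ) : ℂ)
    rw [hv j, hv j']
    intro h
    apply hp
    rw [← Set.mem_range, ← Set.mem_range]
    by_cases h1 : p ∈ Set.range (sqWord j) <;> by_cases h2 : p ∈ Set.range (sqWord j')
    · exact iff_of_true h1 h2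
    · rw [if_pos h1, if_neg h2] at h; norm_num at h
    · rw [if_neg h1, if_pos h2] at h; norm_num at h
    · exact iff_of_false h1 h2

include he in
/-- **Permutation symmetries**: some automorphism permuting the lattice basis sends the `j`-th singular
basis vector to `±` the `j'`-th. [cite: LangeBirkenhake1992, §1.1.2 and §1.1.4] -/
theorem exists_permOperator (j j' : Fin 6) :
    ∃ P : singularCohomology ℂ ℂ (Torus τ hτ) 2 →ₗ[ℂ] singularCohomology ℂ ℂ (Torus τ hτ) 2,
      (∀ s ∈ {c : singularCohomology ℂ ℂ (Torus τ hτ) 2 | IsRationalClass c},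
        P s ∈ {c : singularCohomology ℂ ℂ (Torus τ hτ) 2 | IsRationalClass c}) ∧
      ∃ ε : ℂ, (ε = 1 ∨ ε = -1) ∧ P (singBasis τ hτ e j) = ε • singBasis τ hτ e j' := by
  obtain ⟨π, hπ⟩ := exists_perm_comp_eq (injective_sqWord_apply j) (injective_sqWord_apply j')
  refine ⟨torusPullback τ hτ (signedPermMatrix (fun _ ↦ 1) π),
    fun x hx ↦ torusPullback_mem τ hτ _ hx, 1, Or.inl rfl, ?_⟩
  rw [singBasis_apply, singBasis_apply, deRhamBasis_apply, deRhamBasis_apply,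
    torusPullback_e_latMonomial τ hτ he, hπ, Finset.prod_const_one, Int.cast_one]

include he in
/-- **The rational structure of `H²(ℂ²/(ℤ + τℤ)²; ℂ)` in the de Rham basis.** For every natural
complex de Rham isomorphism family `e` on manifolds charted on `ℂ²` there is ONE scalar `c ≠ 0` such
that the six classes `c · e[dx_a ∧ dx_b ∧ 1]`, `a < b`, are RATIONAL classes of `H²(T_τ; ℂ)` (and
every rational class is a rational combination of them with unique coefficients). Lange–Birkenhake
Lemma 1.1.17 with Prop. 1.1.20; here from naturality of `e` and
`exists_ratBasis_smul_basis_of_signOperators`. [cite: LangeBirkenhake1992, §1.1.3 Lemma 1.1.17 and §1.1.4 Prop. 1.1.20] -/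
theorem exists_smul_deRhamBasis_isRationalClass :
    ∃ c : ℂ, c ≠ 0 ∧ (∀ j, IsRationalClass (c • deRhamIso τ hτ e (deRhamBasis τ hτ j))) ∧
      ∀ x : singularCohomology ℂ ℂ (Torus τ hτ) 2, IsRationalClass x →
        ∃! q : Fin 6 → ℚ, ∑ j, ((q j : ℚ) : ℂ) • (c • deRhamIso τ hτ e (deRhamBasis τ hτ j)) = x := by
  obtain ⟨c, hc, hmem, huniq⟩ := exists_ratBasis_smul_basis_of_signOperators
    (singBasis τ hτ e) (isRatSubspace_isRationalClass 2) (isRational_isRationalClass 2)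
    (exists_full_isRationalClass τ hτ e)
    (fun j j' hjj' ↦ exists_signOperator τ hτ he hjj') (fun j j' ↦ exists_permOperator τ hτ he j j')
  refine ⟨c, hc, fun j ↦ ?_, fun x hx ↦ ?_⟩
  · have h := hmem j
    rwa [singBasis_apply] at h
  · have h := huniq x hx
    simpa only [singBasis_apply] using h

end DeRham

end WeilSquare

end Literature.AlgebraicGeometry.HodgeTheory

end
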